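import Mathlib
import HarnessLib

/-!
# From reflection-invariance of a polynomial on a family of planes to the infinitesimal (generator) identity

Tool for the piece `TorusReduction` of the typed split of stub `:146 stub_oddModeRigidity` (crux ⟨stmt-QuantumFields-23035⟩
`ShortRootRigidity`, `Cruxes/ShortRootRigidity/Lines/odd_mode_split.lean`; `TrigonalInjectivity.md` §2).  The hypothesis
`EvenPartSliceInvariant` of `NoBadModes L` says that a polynomial `E` (the even part of `h` along the plane `Π₀`) takes the same value
at `y₀a + y₁b + x₀c + x₁d` and at `(Ry)₀a + (Ry)₁b + x₀c + x₁d` for every planar isometry `R` of `y ∈ ℝ²`.  This file turns that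
GLOBAL invariance into the INFINITESIMAL identity used by the torus-weight bookkeeping of §2 — with no calculus: the composition of
the reflections across `(1,t)^⊥` and across `e₁^⊥` is, up to the factor `(1+t²)`, POLYNOMIAL in `t` (stereographic parametrisation of
the rotation group), homogeneity of `E` absorbs the factor, and the coefficient of `t¹` of the resulting polynomial identity
`E(path(t)) = (1+t²)^L·E(point)` is the generator identity `Σᵢ (−y₁aᵢ + y₀bᵢ)·∂ᵢE = 0`.

Main result: `generator_eval_eq_zero`.  Ingredients of independent use: `reflection_orthogonal_singleton_apply` (the reflection of
`ℝ²` across `v^⊥` in coordinates), `coeff_one_aeval` (first-order Taylor coefficient of a polynomial substitution),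
`eval_aeval_polynomial`, `coeff_one_one_add_X_sq_pow`, `eval_smul_of_isHomogeneous'`.

HONEST LABEL: a lemma; `TorusReduction`, `AnalyticHalf`, `:146`, ⟨23035⟩, ⟨23125⟩ OPEN; the Yang–Mills mass gap is NOT proved.
-/

noncomputable section

open MvPolynomial
open scoped BigOperators InnerProductSpace Polynomial

namespace Summit.QuantumFields.YangMills.Theorems.F4SubCurvatureDoorTorusReductionSliceGenerator

/-- the Euclidean plane -/
abbrev E2 := EuclideanSpace ℝ (Fin 2)

/-! ## Reflections of `ℝ²` in coordinates -/

/-- The reflection across the line `v^⊥` (`v ≠ 0`): `y ↦ y − (2⟪v,y⟫/‖v‖²)·v`. [folklore] -/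
theorem reflection_orthogonal_singleton_apply (v y : E2) (hv : v ≠ 0) :
    (ℝ ∙ v)ᗮ.reflection y = y - (2 * ⟪v, y⟫_ℝ / ‖v‖ ^ 2) • v := by
  set c : ℝ := ⟪v, y⟫_ℝ / ‖v‖ ^ 2 with hc
  have hv2 : ‖v‖ ^ 2 ≠ 0 := by positivity
  have hdec : y = c • v + (y - c • v) := by abel
  have hperp : y - c • v ∈ (ℝ ∙ v)ᗮ := by
    rw [Submodule.mem_orthogonal_singleton_iff_inner_right, inner_sub_right, inner_smul_right, real_inner_self_eq_norm_sq, hc]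
    field_simp
    ring
  have h1 : (ℝ ∙ v)ᗮ.reflection v = -v := Submodule.reflection_orthogonalComplement_singleton_eq_neg v
  have h2 : (ℝ ∙ v)ᗮ.reflection (y - c • v) = y - c • v := Submodule.reflection_mem_subspace_eq_self hperp
  calc (ℝ ∙ v)ᗮ.reflection y = (ℝ ∙ v)ᗮ.reflection (c • v + (y - c • v)) := by rw [← hdec]
    _ = c • (ℝ ∙ v)ᗮ.reflection v + (ℝ ∙ v)ᗮ.reflection (y - c • v) := by rw [map_add, map_smul]
    _ = c • (-v) + (y - c • v) := by rw [h1, h2]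
    _ = y - (2 * ⟪v, y⟫_ℝ / ‖v‖ ^ 2) • v := by
      rw [hc, smul_neg, show (2 * ⟪v, y⟫_ℝ / ‖v‖ ^ 2) = 2 * (⟪v, y⟫_ℝ / ‖v‖ ^ 2) by ring, mul_smul, two_smul]
      abel

/-- the vector of `ℝ²` with coordinates `(a, b)` -/
def mk2 (a b : ℝ) : E2 := (WithLp.equiv 2 (Fin 2 → ℝ)).symm ![a, b]

/-- coordinates of `mk2` -/
@[simp] theorem mk2_apply_zero (a b : ℝ) : mk2 a b 0 = a := by simp [mk2]
/-- coordinates of `mk2` -/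
@[simp] theorem mk2_apply_one (a b : ℝ) : mk2 a b 1 = b := by simp [mk2]

/-- inner product in coordinates -/
theorem inner_mk2 (a b : ℝ) (y : E2) : ⟪mk2 a b, y⟫_ℝ = a * y 0 + b * y 1 := by
  simp [mk2, PiLp.inner_apply, Fin.sum_univ_two]
  ring

/-- norm squared in coordinates -/
theorem norm_sq_mk2 (a b : ℝ) : ‖mk2 a b‖ ^ 2 = a ^ 2 + b ^ 2 := by
  rw [← real_inner_self_eq_norm_sq, inner_mk2, mk2_apply_zero, mk2_apply_one]
  ring

/-- `mk2 a b ≠ 0` as soon as `a ≠ 0` -/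
theorem mk2_ne_zero (a b : ℝ) (ha : a ≠ 0) : mk2 a b ≠ 0 := by
  intro h
  have := congrArg (fun z : E2 => z 0) h
  simp at this
  exact ha this

/-- Coordinates of the reflection of `y` across `(a,b)^⊥`, cleared of denominators. -/
theorem reflection_mk2_apply (a b : ℝ) (ha : a ≠ 0) (y : E2) (j : Fin 2) :
    (a ^ 2 + b ^ 2) * ((ℝ ∙ mk2 a b)ᗮ.reflection y) j = (a ^ 2 + b ^ 2) * y j - 2 * (a * y 0 + b * y 1) * (mk2 a b) j := by
  have hn : a ^ 2 + b ^ 2 ≠ 0 := by positivity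
  rw [reflection_orthogonal_singleton_apply _ _ (mk2_ne_zero a b ha), inner_mk2, norm_sq_mk2]
  simp only [PiLp.sub_apply, PiLp.smul_apply, smul_eq_mul]
  field_simp

/-! ## Polynomial substitution: evaluation and the first-order Taylor coefficient -/

/-- `(aeval q P)(t) = P(q₀(t), …)`. -/
theorem eval_aeval_polynomial {n : ℕ} (q : Fin n → ℝ[X]) (P : MvPolynomial (Fin n) ℝ) (t : ℝ) :
    (aeval q P).eval t = eval (fun j => (q j).eval t) P := by
  induction P using MvPolynomial.induction_on with
  | C a => simp
  | add p r hp hr => simp [hp, hr]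
  | mul_X p i hp => simp [hp]

/-- **First-order Taylor coefficient of a polynomial substitution**:
`[t¹] P(q(t)) = Σᵢ [t¹]qᵢ · (∂ᵢP)(q(0))`. [folklore] -/
theorem coeff_one_aeval {n : ℕ} (q : Fin n → ℝ[X]) (P : MvPolynomial (Fin n) ℝ) :
    (aeval q P).coeff 1 = ∑ i, (q i).coeff 1 * eval (fun j => (q j).coeff 0) (pderiv i P) := by
  induction P using MvPolynomial.induction_on with
  | C a => simp
  | add p r hp hr =>
    simp only [map_add, Polynomial.coeff_add, hp, hr, ← Finset.sum_add_distrib]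
    refine Finset.sum_congr rfl fun i _ => ?_
    ring
  | mul_X p i hp =>
    set c0 : Fin n → ℝ := fun j => (q j).coeff 0 with hc0
    have h0 : (aeval q p).coeff 0 = eval c0 p := by
      rw [Polynomial.coeff_zero_eq_eval_zero, eval_aeval_polynomial]
      have hfun : (fun j => (q j).eval 0) = c0 := by
        funext j
        simp only [hc0, Polynomial.coeff_zero_eq_eval_zero]
      rw [hfun]
    -- left-hand side: `[t¹](A·qᵢ) = A₀·[t¹]qᵢ + [t¹]A·qᵢ(0)`
    rw [map_mul, aeval_X, Polynomial.coeff_mul, Finset.Nat.sum_antidiagonal_eq_sum_range_succ_mk]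
    simp only [Finset.sum_range_succ, Finset.sum_range_zero, zero_add, Nat.sub_zero, Nat.sub_self, hp, h0]
    -- right-hand side: Leibniz
    have hR : ∀ j, eval c0 (pderiv j (p * X i)) = eval c0 p * eval c0 (pderiv j (X i)) + c0 i * eval c0 (pderiv j p) := by
      intro j
      rw [Derivation.leibniz, smul_eq_mul, smul_eq_mul, map_add, map_mul, map_mul, eval_X]
    simp_rw [hR, mul_add, Finset.sum_add_distrib]
    have h1 : ∑ j, (q j).coeff 1 * (eval c0 p * eval c0 (pderiv j (X i))) = eval c0 p * (q i).coeff 1 := by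
      rw [Finset.sum_eq_single i]
      · simp [mul_comm]
      · intro j _ hj
        simp [pderiv_X_of_ne (Ne.symm hj)]
      · intro h; exact absurd (Finset.mem_univ i) h
    have h2 : ∑ j, (q j).coeff 1 * (c0 i * eval c0 (pderiv j p)) = (∑ j, (q j).coeff 1 * eval c0 (pderiv j p)) * c0 i := by
      rw [Finset.sum_mul]
      refine Finset.sum_congr rfl fun j _ => ?_
      ring
    rw [h1, h2]

/-- `[t¹](1+t²)^L = 0`. -/
theorem coeff_one_one_add_X_sq_pow (L : ℕ) : (((1 : ℝ[X]) + Polynomial.X ^ 2) ^ L).coeff 1 = 0 := by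
  have h : ((1 : ℝ[X]) + Polynomial.X ^ 2) ^ L = Polynomial.expand ℝ 2 ((1 + Polynomial.X) ^ L) := by
    rw [map_pow, map_add, map_one, Polynomial.expand_X]
  rw [h, Polynomial.coeff_expand (by norm_num)]
  simp

/-- scaling of the values of a form [folklore; as in `Literature/Algebra/Polynomial/NonnegativeFormsSymmetries.lean`] -/
theorem eval_smul_of_isHomogeneous' {σ : Type*} [Fintype σ] (f : MvPolynomial σ ℝ) {m : ℕ} (hf : f.IsHomogeneous m)
    (c : ℝ) (x : σ → ℝ) : eval (c • x) f = c ^ m * eval x f := by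
  rw [eval_eq', eval_eq', Finset.mul_sum]
  refine Finset.sum_congr rfl fun α hα => ?_
  have hdeg : ∑ i, α i = m := by
    have h := hf (mem_support_iff.1 hα)
    rw [Finsupp.weight_apply, Finsupp.sum_fintype _ _ (by simp)] at h
    simpa using h
  simp_rw [Pi.smul_apply, smul_eq_mul, mul_pow, Finset.prod_mul_distrib, Finset.prod_pow_eq_pow_sum, hdeg]
  ring

/-! ## The generator identity -/

/-- the point `y₀a + y₁b + x₀c + x₁d` of `ℝ⁴` -/
def pt (a b c d : Fin 4 → ℝ) (y x : E2) : Fin 4 → ℝ := fun i => y 0 * a i + y 1 * b i + x 0 * c i + x 1 * d i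

/-- **GLOBAL ⇒ INFINITESIMAL.**  If a form `E` of degree `L` on `ℝ⁴` takes the same value at `y₀a + y₁b + x₀c + x₁d` and at
`(Ry)₀a + (Ry)₁b + x₀c + x₁d` for every planar isometry `R` (reflections suffice), then
`Σᵢ (−y₁ aᵢ + y₀ bᵢ)·(∂ᵢE)(y₀a + y₁b + x₀c + x₁d) = 0` — the rotation generator of the `(a,b)`-plane kills `E` along the family.
[TrigonalInjectivity.md §2 (support condition); folklore] -/
theorem generator_eval_eq_zero (E : MvPolynomial (Fin 4) ℝ) {L : ℕ} (hE : E.IsHomogeneous L) (a b c d : Fin 4 → ℝ)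
    (hinv : ∀ (R : E2 ≃ₗᵢ[ℝ] E2) (y x : E2), eval (pt a b c d (R y) x) E = eval (pt a b c d y x) E) (y x : E2) :
    ∑ i, (-(y 1) * a i + y 0 * b i) * eval (pt a b c d y x) (pderiv i E) = 0 := by
  -- it suffices to prove the identity with `y` replaced by `−y` and the opposite sign
  suffices key : ∀ y x : E2, ∑ i, (2 * y 1 * a i - 2 * y 0 * b i) * eval (pt a b c d (-y) x) (pderiv i E) = 0 by
    have h := key (-y) x
    simp only [neg_neg, PiLp.neg_apply] at h
    have h' : ∑ i, (-(y 1) * a i + y 0 * b i) * eval (pt a b c d y x) (pderiv i E) =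
        (1 / 2) * ∑ i, (2 * -y 1 * a i - 2 * -y 0 * b i) * eval (pt a b c d y x) (pderiv i E) := by
      rw [Finset.mul_sum]
      refine Finset.sum_congr rfl fun i _ => ?_
      ring
    rw [h', h, mul_zero]
  intro y x
  -- the polynomial path: `(t²−1)y₀ + 2t y₁`, `(t²−1)y₁ − 2t y₀` on the plane, `(1+t²)x` across
  set K : ℝ := eval (pt a b c d y x) E with hK
  let q : Fin 4 → ℝ[X] := fun i =>
    Polynomial.C (y 0 * a i + y 1 * b i + x 0 * c i + x 1 * d i) * Polynomial.X ^ 2 +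
    Polynomial.C (2 * y 1 * a i - 2 * y 0 * b i) * Polynomial.X +
    Polynomial.C (-(y 0) * a i - y 1 * b i + x 0 * c i + x 1 * d i)
  have hq1 : ∀ i, (q i).coeff 1 = 2 * y 1 * a i - 2 * y 0 * b i := by
    intro i
    simp only [q, Polynomial.coeff_add, Polynomial.coeff_C_mul_X_pow, Polynomial.coeff_C_mul_X, Polynomial.coeff_C]
    norm_num
  have hq0 : (fun j => (q j).coeff 0) = pt a b c d (-y) x := by
    funext j
    simp only [q, pt, Polynomial.coeff_add, Polynomial.coeff_C_mul_X_pow, Polynomial.coeff_C_mul_X, Polynomial.coeff_C,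
      PiLp.neg_apply]
    norm_num
    ring
  -- (★) the value identity for every real `t`
  have hval : ∀ t : ℝ, (aeval q E).eval t = (Polynomial.C K * (1 + Polynomial.X ^ 2) ^ L).eval t := by
    intro t
    -- the two reflections
    have hne01 : mk2 0 1 ≠ 0 := by
      intro h; have := congrArg (fun u : E2 => u 1) h; simp at this
    have h1 := hinv ((ℝ ∙ mk2 0 1)ᗮ.reflection) y x
    have h2 := hinv ((ℝ ∙ mk2 1 t)ᗮ.reflection) ((ℝ ∙ mk2 0 1)ᗮ.reflection y) x
    rw [h1] at h2
    -- coordinates of the composite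
    set z : E2 := (ℝ ∙ mk2 0 1)ᗮ.reflection y with hz
    set w : E2 := (ℝ ∙ mk2 1 t)ᗮ.reflection z with hw
    have hzc : ∀ j : Fin 2, z j = y j - 2 * y 1 * (mk2 0 1) j := by
      intro j
      rw [hz, reflection_orthogonal_singleton_apply _ _ hne01, inner_mk2, norm_sq_mk2]
      simp only [PiLp.sub_apply, PiLp.smul_apply, smul_eq_mul]
      ring
    have hz0 : z 0 = y 0 := by rw [hzc]; simp
    have hz1 : z 1 = -y 1 := by rw [hzc]; simp; ring
    have hw0 : (1 + t ^ 2) * w 0 = (t ^ 2 - 1) * y 0 + 2 * t * y 1 := by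
      have h := reflection_mk2_apply 1 t one_ne_zero z 0
      rw [← hw, hz0, hz1] at h
      simp only [mk2_apply_zero, one_pow] at h
      linear_combination h
    have hw1 : (1 + t ^ 2) * w 1 = (t ^ 2 - 1) * y 1 - 2 * t * y 0 := by
      have h := reflection_mk2_apply 1 t one_ne_zero z 1
      rw [← hw, hz0, hz1] at h
      simp only [mk2_apply_one, one_pow] at h
      linear_combination h
    -- the path point is `(1+t²) · pt w x`
    have hpath : (fun j => (q j).eval t) = (1 + t ^ 2) • pt a b c d w x := by
      funext j
      simp only [q, pt, Pi.smul_apply, smul_eq_mul, Polynomial.eval_add, Polynomial.eval_mul, Polynomial.eval_pow,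
        Polynomial.eval_X, Polynomial.eval_C]
      linear_combination (-(a j)) * hw0 + (-(b j)) * hw1
    rw [eval_aeval_polynomial, hpath, eval_smul_of_isHomogeneous' E hE, h2, ← hK]
    simp [Polynomial.eval_pow]
    ring
  -- hence the polynomials agree, and so do their `t¹` coefficients
  have hpoly : aeval q E = Polynomial.C K * (1 + Polynomial.X ^ 2) ^ L := Polynomial.funext hval
  have hcoeff := congrArg (fun f : ℝ[X] => f.coeff 1) hpoly
  simp only [Polynomial.coeff_C_mul, coeff_one_one_add_X_sq_pow, mul_zero, coeff_one_aeval, hq1, hq0] at hcoeff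
  exact hcoeff

end Summit.QuantumFields.YangMills.Theorems.F4SubCurvatureDoorTorusReductionSliceGenerator

end
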